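import Literature.Geometry.Kaehler.ComplexTorusNonSimpleAbelianFourfoldConditionD
import HarnessLib

/-!
# Every complex abelian fourfold with at least three isogeny factors satisfies condition (D)
# (Moonen–Zarhin Thm. (0.1) (4): such an `X ∼ X₁ × X₂ × X₃` is never in case (a), whose `X₂` is a SIMPLE threefold)

Layer `Literature/Geometry/Kaehler`, namespace `Literature.Geometry.Kaehler.ComplexTorus`; lane `lit-hodgefound`
(Track 2 foundations library), Layer A4 (known cases of `D = B`), prover seat `lit-hodgefound-p17` (generation 51),
self-proposed row g51-#11 — the order-free form of g51-#7's
`IsIsogenous.forall_divisorClasses_powPeriod_eq_hodgeClasses_of_prod_prod_of_finrank_eq_one` (`X ∼ (Y × C₁) × C₂`):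
a complex torus isogenous to a product `X₁ × X₂ × X₃` (either bracketing) of THREE complex abelian varieties of positive
dimensions adding up to `4` — necessarily of dimensions `{2, 1, 1}` in some order — satisfies condition (D),
`ℬ•(Xⁿ) = 𝒟•(Xⁿ)` for all `n`, with no further hypothesis: in Moonen–Zarhin's list the only non-simple exceptional
fourfolds are those of case (a), «`X ∼ X₁ × X₂` where `X₁` is an elliptic curve with complex multiplication … and `X₂` is a
simple abelian threefold», and here the complementary threefold `Y × C` of either curve is not simple ((5.4)–(5.5) with
Cor. (3.9), g51-#6).  THEOREMS ONLY (no definition, no instance, no notation, no named fact; D-0026, net debt 0).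

## Sources, VERBATIM (held `paper:arxiv-math_9901113`)

* B. J. J. Moonen, Yu. G. Zarhin [MoonenZarhin1999LowDim], *Hodge classes on abelian varieties of low dimension*, Math.
  Ann. **315** (1999).  Thm. (0.1) (p0001 L126–L135): «Let `X` be a complex abelian variety with `dim(X) ≤ 4`. … (4)
  Suppose we are not in one of the cases (a), (b), (c) or (d). Then `Hg(X) = Sp_D(V,φ)` and `ℬ•(Xⁿ) = 𝒟•(Xⁿ)` for all
  `n`.»; case (a) (p0001 L77–L80): «`X₁` is an elliptic curve with complex multiplication by an imaginary quadratic field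
  `k` and … `X₂` is a simple abelian threefold such that there exists an embedding `k ↪ End⁰(X₂)`»; cases (b)–(d)
  (p0001 L82–L95: `X` simple); §5 (5.4)–(5.5) (p0009 L82–L100); §3 Cor. (3.9) (p0007 L80–L84).
* H. Lange [Lange2023AbelianVarietiesComplex], *Abelian Varieties over the Complex Numbers* (2023), §1.1.2 (products,
  p. 21), Cor. 1.1.16, §1.1.6 Exercise (1)(a) (one-dimensional tori are elliptic curves `E_τ`).
* B. B. Gordon [Gordon1997], *A survey of the Hodge conjecture for abelian varieties*, Thm. 7.5, 7.6.1–7.6.2.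

## Contents

* **`IsIsogenous.forall_divisorClasses_powPeriod_eq_hodgeClasses_of_prod_prod_of_finrank_add_eq_four`** (`X ∼ (X₁ × X₂) × X₃`),
  `IsIsogenous.forall_divisorClasses_powPeriod_eq_hodgeClasses_of_prod_prod_of_finrank_add_eq_four'` (`X ∼ X₁ × (X₂ × X₃)`),
  and the product itself `IsAbelianVariety.forall_divisorClasses_powPeriod_prod_prod_eq_hodgeClasses_of_finrank_add_eq_four`.
-/

noncomputable section

open Module Matrix

namespace Literature.Geometry.Kaehler

namespace ComplexTorus

section ThreeFactors

variable {ι : Type*} [Fintype ι] [DecidableEq ι] {F : Type*} [NormedAddCommGroup F] [NormedSpace ℂ F]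
  {Φ : (ι → ℝ) ≃L[ℝ] F}
  {ι₁ ι₂ ι₃ : Type} [Fintype ι₁] [Fintype ι₂] [Fintype ι₃] [DecidableEq ι₁] [DecidableEq ι₂] [DecidableEq ι₃]
  {E₁ E₂ E₃ : Type} [NormedAddCommGroup E₁] [NormedSpace ℂ E₁] [FiniteDimensional ℂ E₁] [NormedAddCommGroup E₂]
  [NormedSpace ℂ E₂] [FiniteDimensional ℂ E₂] [NormedAddCommGroup E₃] [NormedSpace ℂ E₃] [FiniteDimensional ℂ E₃]
  {Φ₁ : (ι₁ → ℝ) ≃L[ℝ] E₁} {Φ₂ : (ι₂ → ℝ) ≃L[ℝ] E₂} {Φ₃ : (ι₃ → ℝ) ≃L[ℝ] E₃}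

/-- **EVERY COMPLEX TORUS ISOGENOUS TO A PRODUCT `(X₁ × X₂) × X₃` OF THREE COMPLEX ABELIAN VARIETIES OF POSITIVE
DIMENSIONS ADDING UP TO `4` SATISFIES CONDITION (D)** — the dimensions are `{2, 1, 1}` in some order, the two
one-dimensional factors are elliptic curves `E_τ`, `E_{τ'}`, and `(Y × E_τ) × E_{τ'}` satisfies (D) for every abelian
surface `Y` (g51-#6 ∕ #7); such an `X` is never in case (a) («`X₂` is a simple abelian threefold»).
[cite: MoonenZarhin1999LowDim, Thm. (0.1) (4) (p0001 L126–L135), case (a) (p0001 L77–L80), §5 (5.4)–(5.5) (p0009 L82–L100) and §3 Cor. (3.9)]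
[cite: Lange2023AbelianVarietiesComplex, §1.1.2 (products, p. 21) and §1.1.6 Exercise (1)(a)] [cite: Gordon1997, Thm. 7.5] -/
theorem IsIsogenous.forall_divisorClasses_powPeriod_eq_hodgeClasses_of_prod_prod_of_finrank_add_eq_four
    (hiso : IsIsogenous Φ (prodPeriod (prodPeriod Φ₁ Φ₂) Φ₃)) (h₁ : IsAbelianVariety Φ₁) (h₂ : IsAbelianVariety Φ₂)
    (h₃ : IsAbelianVariety Φ₃) (hp₁ : 0 < finrank ℂ E₁) (hp₂ : 0 < finrank ℂ E₂) (hp₃ : 0 < finrank ℂ E₃)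
    (h4 : finrank ℂ E₁ + finrank ℂ E₂ + finrank ℂ E₃ = 4) :
    ∀ k p, divisorClasses (powPeriod Φ k) p = hodgeClasses (powPeriod Φ k) p := by
  have hcases : (finrank ℂ E₁ = 2 ∧ finrank ℂ E₂ = 1 ∧ finrank ℂ E₃ = 1) ∨
      (finrank ℂ E₁ = 1 ∧ finrank ℂ E₂ = 2 ∧ finrank ℂ E₃ = 1) ∨
      (finrank ℂ E₁ = 1 ∧ finrank ℂ E₂ = 1 ∧ finrank ℂ E₃ = 2) := by omega
  rcases hcases with ⟨ha, hb, hc⟩ | ⟨ha, hb, hc⟩ | ⟨ha, hb, hc⟩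
  · -- `(Y × C) × C'`
    obtain ⟨η, hη⟩ := h₁
    exact hiso.forall_divisorClasses_powPeriod_eq_hodgeClasses_of_prod_prod_of_finrank_eq_one hη ha hb hc
  · -- `(C × Y) × C' ≅ (Y × C) × C'`
    obtain ⟨η, hη⟩ := h₂
    exact (IsIsogenous.trans _ _ _ hiso
      ((isIsomorphic_prodPeriod_comm Φ₁ Φ₂).prod (IsIsomorphic.refl Φ₃)).isIsogenous)
      |>.forall_divisorClasses_powPeriod_eq_hodgeClasses_of_prod_prod_of_finrank_eq_one hη hb ha hc
  · -- `(C × C') × Y ≅ Y × (C × C') ≅ (Y × C) × C'`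
    obtain ⟨η, hη⟩ := h₃
    exact (IsIsogenous.trans _ _ _ hiso
      ((isIsomorphic_prodPeriod_comm (prodPeriod Φ₁ Φ₂) Φ₃).trans (isIsomorphic_prodPeriod_assoc Φ₃ Φ₁ Φ₂).symm).isIsogenous)
      |>.forall_divisorClasses_powPeriod_eq_hodgeClasses_of_prod_prod_of_finrank_eq_one hη hc ha hb

/-- The other bracketing: **every complex torus isogenous to `X₁ × (X₂ × X₃)`, three complex abelian varieties of positive
dimensions adding up to `4`, satisfies condition (D).** [cite: MoonenZarhin1999LowDim, Thm. (0.1) (4) (p0001 L126–L135) and §5 (5.4)–(5.5)]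
[cite: Lange2023AbelianVarietiesComplex, §1.1.2 (products, p. 21)] -/
theorem IsIsogenous.forall_divisorClasses_powPeriod_eq_hodgeClasses_of_prod_prod_of_finrank_add_eq_four'
    (hiso : IsIsogenous Φ (prodPeriod Φ₁ (prodPeriod Φ₂ Φ₃))) (h₁ : IsAbelianVariety Φ₁) (h₂ : IsAbelianVariety Φ₂)
    (h₃ : IsAbelianVariety Φ₃) (hp₁ : 0 < finrank ℂ E₁) (hp₂ : 0 < finrank ℂ E₂) (hp₃ : 0 < finrank ℂ E₃)
    (h4 : finrank ℂ E₁ + finrank ℂ E₂ + finrank ℂ E₃ = 4) :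
    ∀ k p, divisorClasses (powPeriod Φ k) p = hodgeClasses (powPeriod Φ k) p :=
  (IsIsogenous.trans _ _ _ hiso (isIsomorphic_prodPeriod_assoc Φ₁ Φ₂ Φ₃).symm.isIsogenous)
    |>.forall_divisorClasses_powPeriod_eq_hodgeClasses_of_prod_prod_of_finrank_add_eq_four h₁ h₂ h₃ hp₁ hp₂ hp₃ h4

omit [Fintype ι] [DecidableEq ι] [NormedAddCommGroup F] [NormedSpace ℂ F] in
/-- The product itself: **`(X₁ × X₂) × X₃` satisfies condition (D) for complex abelian varieties `X₁, X₂, X₃` of positive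
dimensions adding up to `4`.** [cite: MoonenZarhin1999LowDim, Thm. (0.1) (4) (p0001 L126–L135) and §5 (5.4)–(5.5)] [cite: Gordon1997, Thm. 7.5] -/
theorem IsAbelianVariety.forall_divisorClasses_powPeriod_prod_prod_eq_hodgeClasses_of_finrank_add_eq_four
    (h₁ : IsAbelianVariety Φ₁) (h₂ : IsAbelianVariety Φ₂) (h₃ : IsAbelianVariety Φ₃) (hp₁ : 0 < finrank ℂ E₁)
    (hp₂ : 0 < finrank ℂ E₂) (hp₃ : 0 < finrank ℂ E₃) (h4 : finrank ℂ E₁ + finrank ℂ E₂ + finrank ℂ E₃ = 4) :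
    ∀ k p, divisorClasses (powPeriod (prodPeriod (prodPeriod Φ₁ Φ₂) Φ₃) k) p =
      hodgeClasses (powPeriod (prodPeriod (prodPeriod Φ₁ Φ₂) Φ₃) k) p :=
  (IsIsogenous.refl _).forall_divisorClasses_powPeriod_eq_hodgeClasses_of_prod_prod_of_finrank_add_eq_four h₁ h₂ h₃ hp₁
    hp₂ hp₃ h4

end ThreeFactors

end ComplexTorus

end Literature.Geometry.Kaehler
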